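import Literature.NumberTheory.LFunctions.WeilExplicitDirichlet
import Literature.NumberTheory.LFunctions.WeilExplicitArchParitySech
import Mathlib.Analysis.SpecialFunctions.ImproperIntegrals
import HarnessLib

/-!
# GRH arm (rh-explicit, venture WeilGRH): the ODD archimedean weight differs from the even one by
  `π sech(πt)` — the parity correction of `W_χ` is bounded

Cell `rh-explicit`, WEIL TRACK (structure seat weil-3, gen8).  The archimedean term of Weil's functional
for a character of parity `κ` is `(1/2π)∫ k̂(½+it)·Re ψ(¼ + κ/2 + it/2) dt + k(0) log(q/π)`
(`weilArchTermChar`).  For EVEN `χ` the weight is `ζ`'s, whence the counting law of every even `χ`-rung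
measure through the `ζ` estimate (`WeilBochnerMeasureCountingChar`, `weilFunctionalChar_eq_sub_polar_add`).
The ODD weight is the even one plus `π sech(πt)` — the tree's
`WeilArchParity.re_digamma_par_one_sub_zero` (`Re ψ(¾ + it/2) − Re ψ(¼ + it/2) = π / cosh(πt)`, reflection
formula; the Mellin image of `ρ₀ − ρ₁ = 1/(2 cosh(x/2))`; for SMOOTH tests the difference of the two
archimedean integrals is `WeilArchParity.weilArchIntegralChar_one_sub_zero_eq_integral_freq`).  Here the
same subtraction is carried out for the CONTINUOUS kernels of the counting law (Selberg kernels are not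
smooth), under explicit integrability hypotheses: for an ODD character `χ` mod `q ≠ 1` and a continuous
kernel `k` of the first window (`tsupport k ⊆ [−log 2, log 2]`, no prime enters),

  `W_χ(k) = W(k) − (k̂(0) + k̂(1)) + k(0) log q + (1/2π)∫ k̂(½+it)·π/cosh(πt) dt`
    (`weilFunctionalChar_odd_eq_sub_polar_add`),

and the parity correction is BOUNDED by the sup of `k̂` on the line:
`‖(1/2π)∫ k̂(½+it)·π sech(πt) dt‖ ≤ (π/2)·sup_t ‖k̂(½+it)‖` (`norm_parityCorrection_le`, via
`π sech(πt) ≤ π(1+t²)⁻¹`, `∫(1+t²)⁻¹ = π`).  For the Selberg kernels of the counting law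
(`‖F±‖ ≤ 3e^{2π}` uniformly in `T`) the correction is therefore `O(1)`: the odd-`χ` counting law has the
same main term `θ(T)/π + (T/2π) log q` (successor: port `exists_weil_side_bound_char` and
`WeilBochnerMeasureCountingChar` with this lemma in place of the even reduction).

No definitions, no named facts, RH/GRH-free.

## References

* G. E. Andrews, R. Askey, R. Roy, *Special Functions* (1999), (1.2.15) (reflection for `ψ`).
  [AndrewsAskeyRoy1999]
* A. Weil, *Sur les "formules explicites" de la théorie des nombres premiers* (1952), (11): the kernels
  `K_{1,f}`, `f ∈ {0,1}`. [Weil1952FormulesExplicites]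
-/

set_option autoImplicit false

noncomputable section

open Complex Filter Set MeasureTheory
open scoped Real Topology ComplexConjugate

namespace Summit.Ventures.WeilGRH

open Literature.NumberTheory.LFunctions

/-! ## `Re ψ(¾ + it/2) − Re ψ(¼ + it/2) = π sech(πt)` -/

/-- `cosh x ≥ 1 + x²/4` (from `e^x ≥ 1 + x + x²/2` for `x ≥ 0`, `e^{−x} ≥ 1 − x`, and evenness). -/
theorem one_add_sq_div_four_le_cosh (x : ℝ) : 1 + x ^ 2 / 4 ≤ Real.cosh x := by
  wlog hx : 0 ≤ x generalizing x with H
  · have h := H (-x) (by linarith)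
    rwa [Real.cosh_neg, neg_sq] at h
  rw [Real.cosh_eq]
  have h1 := Real.quadratic_le_exp_of_nonneg hx
  have h2 : -x + 1 ≤ Real.exp (-x) := Real.add_one_le_exp (-x)
  linarith

/-- `π / cosh(πt) ≤ π·(1 + t²)⁻¹` (`cosh(πt) ≥ 1 + π²t²/4 ≥ 1 + t²`). -/
theorem pi_div_cosh_le (t : ℝ) : π / Real.cosh (π * t) ≤ π * (1 + t ^ 2)⁻¹ := by
  have h := one_add_sq_div_four_le_cosh (π * t)
  have hπ : 3 < π := Real.pi_gt_three
  have hπ2 : (9 : ℝ) ≤ π ^ 2 := by nlinarith [hπ, Real.pi_pos]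
  have ht2 : t ^ 2 ≤ (π * t) ^ 2 / 4 := by rw [mul_pow]; nlinarith [sq_nonneg t, hπ2]
  have h1 : 1 + t ^ 2 ≤ Real.cosh (π * t) := by linarith
  rw [← div_eq_mul_inv]
  exact div_le_div_of_nonneg_left Real.pi_pos.le (by positivity) h1

/-! ## The odd archimedean integral = the even one + the `sech` correction -/

/-- For parity `1` the digamma weight is `Re ψ(¾ + it/2) = Re ψ(¼ + it/2) + π/cosh(πt)`. -/
theorem re_digamma_parity_one (t : ℝ) :
    (Complex.digamma (1 / 4 + ((1 : ℕ) : ℂ) / 2 + t / 2 * I)).re =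
      (Complex.digamma (1 / 4 + t / 2 * I)).re + π / Real.cosh (π * t) := by
  have h := WeilArchParity.re_digamma_par_one_sub_zero t
  rw [show (1 / 4 : ℂ) + ((0 : ℕ) : ℂ) / 2 + t / 2 * I = 1 / 4 + t / 2 * I by push_cast; ring] at h
  linarith

/-- **The odd archimedean integral splits**: if the even integrand `k̂(½+it)·Re ψ(¼+it/2)` and the
correction `k̂(½+it)·π/cosh(πt)` are integrable, then
`∫ k̂(½+it) Re ψ(¾+it/2) dt = ∫ k̂(½+it) Re ψ(¼+it/2) dt + ∫ k̂(½+it)·π/cosh(πt) dt`. -/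
theorem weilArchIntegralChar_one_eq (g : ℝ → ℂ)
    (h0 : Integrable fun t : ℝ ↦ weilMellin g (1 / 2 + t * I) * ((Complex.digamma (1 / 4 + t / 2 * I)).re : ℂ))
    (hD : Integrable fun t : ℝ ↦ weilMellin g (1 / 2 + t * I) * ((π / Real.cosh (π * t) : ℝ) : ℂ)) :
    weilArchIntegralChar 1 g =
      weilArchIntegralChar 0 g + ∫ t : ℝ, weilMellin g (1 / 2 + t * I) * ((π / Real.cosh (π * t) : ℝ) : ℂ) := by
  rw [weilArchIntegralChar_zero, weilArchIntegralChar, weilArchIntegral, ← integral_add h0 hD]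
  refine integral_congr_ae (Eventually.of_forall fun t ↦ ?_)
  simp only [re_digamma_parity_one, Complex.ofReal_add]
  ring

/-- **On the first window an ODD `χ` mod `q ≠ 1` differs from `ζ` by the polar term, `log q`, and the
`sech` correction**: for a continuous kernel `k` with `tsupport k ⊆ [−log 2, log 2]` and integrable
archimedean integrands,
`W_χ(k) = W(k) − (k̂(0) + k̂(1)) + k(0) log q + (1/2π)∫ k̂(½+it)·π/cosh(πt) dt`.
(Even `χ`: `WeilBochnerMeasureChar.weilFunctionalChar_eq_sub_polar_add`, without the last term.) -/
theorem weilFunctionalChar_odd_eq_sub_polar_add {q : ℕ} {χ : DirichletCharacter ℂ q} (hq : q ≠ 1)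
    (hχ : charParity χ = 1) {k : ℝ → ℂ} (hk : Continuous k)
    (hks : tsupport k ⊆ Icc (-Real.log 2) (Real.log 2))
    (h0 : Integrable fun t : ℝ ↦ weilMellin k (1 / 2 + t * I) * ((Complex.digamma (1 / 4 + t / 2 * I)).re : ℂ))
    (hD : Integrable fun t : ℝ ↦ weilMellin k (1 / 2 + t * I) * ((π / Real.cosh (π * t) : ℝ) : ℂ)) :
    weilFunctionalChar χ k = weilFunctional k - weilPolarTerm k + k 0 * (Real.log q : ℂ) +
      (1 / (2 * π) : ℂ) * ∫ t : ℝ, weilMellin k (1 / 2 + t * I) * ((π / Real.cosh (π * t) : ℝ) : ℂ) := by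
  rw [weilFunctionalChar, if_neg hq, weilPrimeTermChar_eq_zero_of_tsupport_subset χ hk hks, hχ,
    weilArchTermChar, weilArchIntegralChar_one_eq k h0 hD, weilArchIntegralChar_zero, weilFunctional,
    weilPrimeTerm_eq_zero_of_tsupport_subset hk hks, weilArchTerm]
  push_cast
  ring

/-! ## The correction is bounded by the sup of `k̂` on the critical line -/

/-- The `sech` correction integrand is integrable as soon as `k̂` is bounded and measurable on the line. -/
theorem integrable_parityCorrection {Φ : ℝ → ℂ} (hΦm : AEStronglyMeasurable Φ) {K : ℝ}
    (hΦ : ∀ t, ‖Φ t‖ ≤ K) :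
    Integrable fun t : ℝ ↦ Φ t * ((π / Real.cosh (π * t) : ℝ) : ℂ) := by
  have hmaj : Integrable fun t : ℝ ↦ K * (π * (1 + t ^ 2)⁻¹) :=
    (integrable_inv_one_add_sq.const_mul π).const_mul K
  have hc : Continuous fun t : ℝ ↦ ((π / Real.cosh (π * t) : ℝ) : ℂ) :=
    Complex.continuous_ofReal.comp (continuous_const.div
      (Real.continuous_cosh.comp (continuous_const.mul continuous_id)) fun x ↦ (Real.cosh_pos _).ne')
  refine hmaj.mono' (hΦm.mul hc.aestronglyMeasurable) (Eventually.of_forall fun t ↦ ?_)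
  rw [norm_mul, Complex.norm_real, Real.norm_of_nonneg (div_pos Real.pi_pos (Real.cosh_pos _)).le]
  have hK : 0 ≤ K := (norm_nonneg _).trans (hΦ 0)
  exact mul_le_mul (hΦ t) (pi_div_cosh_le t) (div_pos Real.pi_pos (Real.cosh_pos _)).le hK

/-- **The parity correction is bounded**: if `‖k̂(½+it)‖ ≤ K` for all real `t` (and `k̂` is measurable on
the line), then `‖(1/2π)∫ k̂(½+it)·π/cosh(πt) dt‖ ≤ (π/2)·K` (`π/cosh(πt) ≤ π(1+t²)⁻¹`,
`∫(1+t²)⁻¹ = π`).  For the Selberg kernels of the counting law `K = 3e^{2π}` uniformly in `T`. -/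
theorem norm_parityCorrection_le {Φ : ℝ → ℂ} {K : ℝ} (hΦ : ∀ t, ‖Φ t‖ ≤ K) :
    ‖(1 / (2 * π) : ℂ) * ∫ t : ℝ, Φ t * ((π / Real.cosh (π * t) : ℝ) : ℂ)‖ ≤ π / 2 * K := by
  have hK : 0 ≤ K := (norm_nonneg _).trans (hΦ 0)
  have hint : ‖∫ t : ℝ, Φ t * ((π / Real.cosh (π * t) : ℝ) : ℂ)‖ ≤ K * (π * π) := by
    calc ‖∫ t : ℝ, Φ t * ((π / Real.cosh (π * t) : ℝ) : ℂ)‖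
        ≤ ∫ t : ℝ, K * (π * (1 + t ^ 2)⁻¹) := by
          refine norm_integral_le_of_norm_le ((integrable_inv_one_add_sq.const_mul π).const_mul K)
            (Eventually.of_forall fun t ↦ ?_)
          rw [norm_mul, Complex.norm_real, Real.norm_of_nonneg (div_pos Real.pi_pos (Real.cosh_pos _)).le]
          exact mul_le_mul (hΦ t) (pi_div_cosh_le t) (div_pos Real.pi_pos (Real.cosh_pos _)).le hK
      _ = K * (π * π) := by
          rw [integral_const_mul, integral_const_mul, integral_univ_inv_one_add_sq]
  have h2π : ‖(1 / (2 * π) : ℂ)‖ = 1 / (2 * π) := by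
    rw [show (1 / (2 * π) : ℂ) = ((1 / (2 * π) : ℝ) : ℂ) by push_cast; ring, Complex.norm_real,
      Real.norm_of_nonneg (by positivity)]
  rw [norm_mul, h2π]
  calc 1 / (2 * π) * ‖∫ t : ℝ, Φ t * ((π / Real.cosh (π * t) : ℝ) : ℂ)‖
      ≤ 1 / (2 * π) * (K * (π * π)) := mul_le_mul_of_nonneg_left hint (by positivity)
    _ = π / 2 * K := by field_simp

/-- **Corollary — the odd functional is within `(π/2)·sup|k̂|` of the even expression**: for an odd
`χ` mod `q ≠ 1` and a first-window kernel `k` with `‖k̂(½+it)‖ ≤ K` and integrable even integrand,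
`‖W_χ(k) − [W(k) − (k̂(0)+k̂(1)) + k(0) log q]‖ ≤ (π/2)·K`. -/
theorem norm_weilFunctionalChar_odd_sub_le {q : ℕ} {χ : DirichletCharacter ℂ q} (hq : q ≠ 1)
    (hχ : charParity χ = 1) {k : ℝ → ℂ} (hk : Continuous k)
    (hks : tsupport k ⊆ Icc (-Real.log 2) (Real.log 2))
    (h0 : Integrable fun t : ℝ ↦ weilMellin k (1 / 2 + t * I) * ((Complex.digamma (1 / 4 + t / 2 * I)).re : ℂ))
    (hm : AEStronglyMeasurable fun t : ℝ ↦ weilMellin k (1 / 2 + t * I)) {K : ℝ}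
    (hK : ∀ t : ℝ, ‖weilMellin k (1 / 2 + t * I)‖ ≤ K) :
    ‖weilFunctionalChar χ k - (weilFunctional k - weilPolarTerm k + k 0 * (Real.log q : ℂ))‖ ≤ π / 2 * K := by
  have hD := integrable_parityCorrection hm hK
  rw [weilFunctionalChar_odd_eq_sub_polar_add hq hχ hk hks h0 hD, add_sub_cancel_left]
  exact norm_parityCorrection_le hK

end Summit.Ventures.WeilGRH

end
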